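import Mathlib
import Summits.MatrixMultiplication.MatrixMultiplication.Theses.FourierTwoFamiliesModP

/-!
# Sketch (ideator k=1) — first lemmas of two crux idea cards + supporting facts for `PrimeDensityDecay` (stmt-MatrixMultiplication-14311)

Notation (informal): `X = ⊔ A_j`, `Y = ⊔ B_j`, `X₀ = ⋃ (A_j − B_j)` (private differences),
`D̃(d) = #{j : d ∈ A_j − B_j}` (sharing multiplicity), `ρ = n s / p`.
-/

namespace Summit.MatrixMultiplication.MatrixMultiplication.Cruxes.PrimeDensityDecay.Sketch

open scoped BigOperators Pointwise
open Finset
open Summit.MatrixMultiplication.MatrixMultiplication.Theses.FourierTwoFamiliesModP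

/-! ## Card A — low-multiplicity removal dichotomy -/

/-- Number of matched pairs `(a,b) ∈ A i × B i` (over all `i`) whose difference `a - b` is a private
difference of at most `K * s` classes (`D̃(a-b) ≤ K s`): the "low-multiplicity mass". -/
def lowMass {p n : ℕ} (K s : ℕ) (A B : Fin n → Finset (ZMod p)) : ℕ :=
  ∑ i : Fin n, ((A i ×ˢ B i).filter (fun q : ZMod p × ZMod p =>
      (∑ j : Fin n, ((A j ×ˢ B j).filter
        (fun r : ZMod p × ZMod p => r.1 - r.2 = q.1 - q.2)).card) ≤ K * s)).card

/-- FIRST LEMMA (card A, provable now from `Green2005_1_5_holds`, k = 3): if at least half of the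
matched mass `n s²` sits on private differences of multiplicity `≤ K s`, the configuration has
density `≤ ε` once `s ≥ s₀(K, ε)`.  `K`-uniform generalisation of `RemovalRegime` (there `n ≤ K s`
forces every multiplicity `≤ n ≤ K s`). -/
def LowMultiplicityRegime : Prop :=
  ∀ (K : ℕ) (ε : ℝ), 0 < ε → ∃ s₀ : ℕ, ∀ p : ℕ, p.Prime → ∀ (n s : ℕ) (A B : Fin n → Finset (ZMod p)),
    s₀ ≤ s → (∀ i : Fin n, (A i).card = s ∧ (B i).card = s) →
    (∀ i : Fin n, ∀ a ∈ A i, ∀ a' ∈ A i, ∀ b ∈ B i, ∀ b' ∈ B i, (a - a') + (b - b') = 0 → a = a' ∧ b = b') →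
    (∀ i j k : Fin n, ∀ a ∈ A i, ∀ a' ∈ A j, ∀ b ∈ B j, ∀ b' ∈ B k, (a - a') + (b - b') = 0 → i = k) →
    n * s ^ 2 ≤ 2 * lowMass K s A B →
    (n : ℝ) * (s : ℝ) ≤ ε * (p : ℝ)

/-- TRANSFER target `C⁺` (card A): decay for the HEAVY-SHARING CORE only — configurations in which
more than half of the matched mass sits on private differences shared by `> K s` classes, with `K`
at the prover's disposal (may depend on `ε`). -/
def HeavyCoreDecay : Prop :=
  ∀ ε : ℝ, 0 < ε → ∃ K s₀ : ℕ, ∀ p : ℕ, p.Prime → ∀ (n s : ℕ) (A B : Fin n → Finset (ZMod p)),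
    s₀ ≤ s → (∀ i : Fin n, (A i).card = s ∧ (B i).card = s) →
    (∀ i : Fin n, ∀ a ∈ A i, ∀ a' ∈ A i, ∀ b ∈ B i, ∀ b' ∈ B i, (a - a') + (b - b') = 0 → a = a' ∧ b = b') →
    (∀ i j k : Fin n, ∀ a ∈ A i, ∀ a' ∈ A j, ∀ b ∈ B j, ∀ b' ∈ B k, (a - a') + (b - b') = 0 → i = k) →
    2 * lowMass K s A B < n * s ^ 2 →
    (n : ℝ) * (s : ℝ) ≤ ε * (p : ℝ)

/-- The glue of card A, kernel-checked: the two regimes cover the crux. -/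
theorem primeDensityDecay_of_regimes (hL : LowMultiplicityRegime) (hH : HeavyCoreDecay) :
    PrimeDensityDecay := by
  intro ε hε
  obtain ⟨K, s₂, hH'⟩ := hH ε hε
  obtain ⟨s₁, hL'⟩ := hL K ε hε
  refine ⟨max s₁ s₂, ?_⟩
  intro p hp n s A B hs hcard hW hX
  by_cases h : n * s ^ 2 ≤ 2 * lowMass K s A B
  · exact hL' p hp n s A B (le_trans (le_max_left _ _) hs) hcard hW hX h
  · exact hH' p hp n s A B (le_trans (le_max_right _ _) hs) hcard hW hX (Nat.lt_of_not_le h)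

/-! ## Card B — the pair-shadow identity -/

/-- FIRST LEMMA (card B, provable now, elementary): for every class `j`, the translate-unions
`X − A_j` and `Y − B_j` meet exactly in `{0}` and the "2-cycle coincidence set"
`Q_j = ⋃_{i ≠ j} (A_i − A_j) ∩ (B_i − B_j)`. -/
def PairShadowIdentity : Prop :=
  ∀ (p n : ℕ) (A B : Fin n → Finset (ZMod p)),
    (∀ i : Fin n, (A i).Nonempty) →
    (∀ i : Fin n, ∀ a ∈ A i, ∀ a' ∈ A i, ∀ b ∈ B i, ∀ b' ∈ B i, (a - a') + (b - b') = 0 → a = a' ∧ b = b') →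
    (∀ i j k : Fin n, ∀ a ∈ A i, ∀ a' ∈ A j, ∀ b ∈ B j, ∀ b' ∈ B k, (a - a') + (b - b') = 0 → i = k) →
    ∀ j : Fin n,
      (Finset.univ.biUnion A - A j) ∩ (Finset.univ.biUnion B - B j) =
        {0} ∪ (Finset.univ.filter (fun i => i ≠ j)).biUnion (fun i => (A i - A j) ∩ (B i - B j))

/-- Card B, second statement (provable now): the coincidence pieces are pairwise DISJOINT
(isolation of common edges), so `∑_{i ≠ j} |(A_i − A_j) ∩ (B_i − B_j)| ≤ p`. -/
def PairShadowDisjoint : Prop :=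
  ∀ (p n : ℕ) (A B : Fin n → Finset (ZMod p)),
    (∀ i : Fin n, ∀ a ∈ A i, ∀ a' ∈ A i, ∀ b ∈ B i, ∀ b' ∈ B i, (a - a') + (b - b') = 0 → a = a' ∧ b = b') →
    (∀ i j k : Fin n, ∀ a ∈ A i, ∀ a' ∈ A j, ∀ b ∈ B j, ∀ b' ∈ B k, (a - a') + (b - b') = 0 → i = k) →
    ∀ j i i' : Fin n, i ≠ j → i' ≠ j → i ≠ i' →
      Disjoint ((A i - A j) ∩ (B i - B j)) ((A i' - A j) ∩ (B i' - B j))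

/-! ## Supporting facts for the heavy-sharing core (quoted in card A Transfer, card B (4)) -/

/-- FIRST LEMMA (card C, provable now): a pair of classes `i ≠ j` overlapping after a common
displacement `d` exports the private differences of the overlap rectangle out of `X₀` at `± d`. -/
def SimilarityExport : Prop :=
  ∀ (p n : ℕ) (A B : Fin n → Finset (ZMod p)),
    (∀ i : Fin n, ∀ a ∈ A i, ∀ a' ∈ A i, ∀ b ∈ B i, ∀ b' ∈ B i, (a - a') + (b - b') = 0 → a = a' ∧ b = b') →
    (∀ i j k : Fin n, ∀ a ∈ A i, ∀ a' ∈ A j, ∀ b ∈ B j, ∀ b' ∈ B k, (a - a') + (b - b') = 0 → i = k) →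
    ∀ i j : Fin n, i ≠ j → ∀ d : ZMod p,
      ((A i ∩ (A j + {d})) - (B i ∩ (B j + {d}))).card
          = (A i ∩ (A j + {d})).card * (B i ∩ (B j + {d})).card ∧
      Disjoint ((A i ∩ (A j + {d})) - (B i ∩ (B j + {d})) + {d}) (Finset.univ.biUnion fun k => A k - B k) ∧
      Disjoint ((A i ∩ (A j + {d})) - (B i ∩ (B j + {d})) - {d}) (Finset.univ.biUnion fun k => A k - B k)

/-- Card C, quantitative first lemma (provable now): classes that are common translates of one
another pack — `|S| · s² ≤ p` — hence density `ρ ≤ f / s` for a family with `f` translation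
shapes. -/
def TranslatePacking : Prop :=
  ∀ p : ℕ, p.Prime → ∀ (n s : ℕ) (A B : Fin n → Finset (ZMod p)),
    (∀ i : Fin n, (A i).card = s ∧ (B i).card = s) →
    (∀ i : Fin n, ∀ a ∈ A i, ∀ a' ∈ A i, ∀ b ∈ B i, ∀ b' ∈ B i, (a - a') + (b - b') = 0 → a = a' ∧ b = b') →
    (∀ i j k : Fin n, ∀ a ∈ A i, ∀ a' ∈ A j, ∀ b ∈ B j, ∀ b' ∈ B k, (a - a') + (b - b') = 0 → i = k) →
    ∀ (S : Finset (Fin n)) (t : Fin n → ZMod p),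
      (∀ i ∈ S, ∀ i' ∈ S, A i' = A i + {t i' - t i} ∧ B i' = B i + {t i' - t i}) →
      S.card * s ^ 2 ≤ p

end Summit.MatrixMultiplication.MatrixMultiplication.Cruxes.PrimeDensityDecay.Sketch
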